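import Summits.BirchSwinnertonDyer.Rank1Residual.Iwasawa.UnramifiedConditionFiniteOrbit
import Literature.NumberTheory.EllipticCurves.KellerYin2024.AnticyclotomicLocalEulerFactors
import HarnessLib

/-!
# `Γ_K = H · D_w · {γⁿ : n < [Γ : Γ_w]}` — the representative count at a finitely decomposed place of a
# `ℤ_p`-extension is at most Keller–Yin's `numPlacesAbove κ w`

Cell `bsd-eis`, seat `bsd-line-x1-p1` (LEAD, D-0154 row 4), crux 2 `GoodLatticeBDPValue`
(stmt-BirchSwinnertonDyer-19032), line `halves` v14, stub `stub_imprimCorank` (`≤` half of the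
`S`-relaxation corank identity). Tool theorems only (no definition, no named fact, no `sorry`).

n1011's `Iwasawa.exists_forall_eq_mul_decomp_mul_pow` factors every `σ ∈ Γ_K` as `h · δ · γⁿ`
(`h ∈ ker κ`, `δ ∈ D_w`, `n < p^m`) with `p^m` read off ANY `δ₀ ∈ D_w` with `κ δ₀ ≠ 1`; the optimal
count is the index `[Γ : Γ_w]` of `κ(D_w)` in `ℤ_p`, which is the tree's `numPlacesAbove κ w` (the
factor of `charLocalLambda` / `curveLocalLambda`, file `KellerYin2024/AnticyclotomicLocalEulerFactors`).
This file proves the factorisation with the bound `numPlacesAbove κ w`: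

* `numPlacesAbove_ne_zero` — at a finitely decomposed `w`, `κ(D_w)` has finite index in `ℤ_p`;
* **`exists_lt_numPlacesAbove_eq_mul_decomp_mul_pow`** — every `σ ∈ Γ_K` is `h · (δ · γⁿ)` with
  `h ∈ ker κ`, `δ ∈ D_w`, `n < numPlacesAbove κ w`.

Proof: `κ(D_w) ⊇ {y : ‖y‖ ≤ ‖κ δ₀‖}` (`exists_mem_decomp_apply_eq_of_norm_le`) makes `n ↦ γⁿ`,
`n < p^m`, surject onto `ℤ_p/κ(D_w)`, so the index `N` is finite; then `γ^N ∈ κ⁻¹(κ(D_w))`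
(`Subgroup.pow_index_mem`) provides `δ₁ ∈ D_w` with `κ δ₁ = N`, and n1011's argument at `δ₁` gives
`n < p^{v_p(N)} ≤ N`. References: [GreenbergVatsal2000] §2 p. 21 (`s_ℓ`); [KellerYin2024] Lemma 1.0.1,
Lemma 1.1.1 (arXiv:2402.12781v2 TeX L388, L455); [Washington1997] §13.1.
-/

set_option linter.dupNamespace false
set_option autoImplicit false

noncomputable section

open scoped Classical

open NumberField IsDedekindDomain Field
open Literature.NumberTheory.EllipticCurves Literature.NumberTheory.EllipticCurves.GreenbergSelmer
  Literature.NumberTheory.EllipticCurves.KellerYin2024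
  Summit.BirchSwinnertonDyer.Rank1Residual.Iwasawa

universe u

namespace Summit.BirchSwinnertonDyer.BirchSwinnertonDyer.Theorems.DecompositionCountNumPlaces

variable {K : Type} [Field K] [NumberField K] {p : ℕ} [Fact p.Prime] (κ : ZpExtension K p)
  {w : HeightOneSpectrum (𝓞 K)}

/-- The image `κ(D_w) ≤ ℤ_p` as a subgroup of `Multiplicative ℤ_[p]` (local abbreviation through a
`theorem`-free `let`; `numPlacesAbove κ w` is its index by definition). [cite: KellerYin2024, Lemma 1.1.1 (arXiv:2402.12781v2)] -/
theorem numPlacesAbove_eq_index (w : HeightOneSpectrum (𝓞 K)) :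
    numPlacesAbove κ w = ((decomp (K := K) w).map κ.toContinuousMonoidHom.toMonoidHom).index :=
  rfl

/-- Membership in `κ(D_w)`: `κ δ` for `δ ∈ D_w`. [folklore] -/
theorem apply_mem_map_decomp {δ : absoluteGaloisGroup K} (hδ : δ ∈ decomp (K := K) w) :
    κ δ ∈ (decomp (K := K) w).map κ.toContinuousMonoidHom.toMonoidHom :=
  ⟨δ, hδ, rfl⟩

/-- **At a finitely decomposed place the index `[Γ : Γ_w]` is finite**: if some `δ₀ ∈ D_w` has
`κ δ₀ ≠ 1`, then `numPlacesAbove κ w ≠ 0`. The classes of `γⁿ`, `n < p^m` (`m = v_p(κ δ₀)`), exhaust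
`ℤ_p / κ(D_w)` because `κ(D_w)` contains the ball `‖·‖ ≤ ‖κ δ₀‖`
(`exists_mem_decomp_apply_eq_of_norm_le`). [cite: GreenbergVatsal2000, §2 p. 21] [cite: Washington1997, §13.1] -/
theorem numPlacesAbove_ne_zero {δ₀ : absoluteGaloisGroup K} (hδ₀ : δ₀ ∈ decomp (K := K) w)
    (hne : κ δ₀ ≠ 1) : numPlacesAbove κ w ≠ 0 := by
  set D := (decomp (K := K) w).map κ.toContinuousMonoidHom.toMonoidHom with hD
  set a : ℤ_[p] := (κ δ₀).toAdd with ha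
  have ha0 : a ≠ 0 := fun h ↦ hne (by rw [← ofAdd_toAdd (κ δ₀), ← ha, h]; rfl)
  rw [numPlacesAbove_eq_index]
  -- the classes of `ofAdd n`, `n < p^m`, exhaust the quotient
  let f : Fin (p ^ a.valuation) → Multiplicative ℤ_[p] ⧸ D := fun n ↦
    QuotientGroup.mk (Multiplicative.ofAdd ((n : ℕ) : ℤ_[p]))
  have hf : Function.Surjective f := by
    intro q
    obtain ⟨g, rfl⟩ := QuotientGroup.mk_surjective q
    set x : ℤ_[p] := g.toAdd with hx
    refine ⟨⟨x.appr a.valuation, PadicInt.appr_lt x _⟩, ?_⟩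
    have hy : ‖x - (x.appr a.valuation : ℤ_[p])‖ ≤ ‖a‖ := by
      rw [PadicInt.norm_eq_zpow_neg_valuation ha0, PadicInt.norm_le_pow_iff_mem_span_pow]
      exact PadicInt.appr_spec _ x
    obtain ⟨δ, hδ, hκδ⟩ := exists_mem_decomp_apply_eq_of_norm_le κ hδ₀ hne hy
    change QuotientGroup.mk (Multiplicative.ofAdd ((x.appr a.valuation : ℕ) : ℤ_[p])) =
      QuotientGroup.mk g
    rw [QuotientGroup.eq]
    refine ⟨δ, hδ, ?_⟩
    change κ δ = _
    rw [hκδ, ← ofAdd_toAdd g, ← hx, ← ofAdd_neg, ← ofAdd_add, neg_add_eq_sub]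
  haveI : Finite (Multiplicative ℤ_[p] ⧸ D) := Finite.of_surjective f hf
  exact Subgroup.index_ne_zero_of_finite

/-- **`Γ_K = H · D_w · {γⁿ : n < numPlacesAbove κ w}`**: over a `ℤ_p`-extension `κ` with topological
generator `γ`, at a finitely decomposed place `w` (some `δ₀ ∈ D_w` with `κ δ₀ ≠ 1`) every
`σ ∈ Γ_K` factors as `σ = h · (δ · γⁿ)` with `h ∈ ker κ`, `δ ∈ D_w` and `n < numPlacesAbove κ w`
(= `[Γ : Γ_w]`, the number of places of `K_∞` above `w`). With `N = numPlacesAbove κ w` (finite by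
`numPlacesAbove_ne_zero`), `γ^N` maps into `κ(D_w)` (`Subgroup.pow_index_mem`), so some `δ₁ ∈ D_w` has
`κ δ₁ = N ≠ 0`; n1011's `exists_forall_eq_mul_decomp_mul_pow` at `δ₁` gives `n < p^{v_p(N)}`, and
`p^{v_p(N)} ∣ N`. [cite: GreenbergVatsal2000, §2 p. 21] [cite: KellerYin2024, Lemma 1.0.1, Lemma 1.1.1 (arXiv:2402.12781v2 TeX L388, L455)] -/
theorem exists_lt_numPlacesAbove_eq_mul_decomp_mul_pow {γ : absoluteGaloisGroup K}
    (hγ : κ.IsTopGenerator γ) {δ₀ : absoluteGaloisGroup K} (hδ₀ : δ₀ ∈ decomp (K := K) w)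
    (hne : κ δ₀ ≠ 1) (σ : absoluteGaloisGroup K) :
    ∃ n < numPlacesAbove κ w, ∃ δ ∈ decomp (K := K) w, ∃ h ∈ κ.kerSubgroup,
      σ = h * (δ * γ ^ n) := by
  set D := (decomp (K := K) w).map κ.toContinuousMonoidHom.toMonoidHom with hD
  set N := numPlacesAbove κ w with hN
  have hN0 : N ≠ 0 := numPlacesAbove_ne_zero κ hδ₀ hne
  -- `γ^N ↦ N ∈ κ(D_w)`
  have hpow : κ (γ ^ N) ∈ D := by
    rw [map_pow]
    have h := Subgroup.pow_index_mem D (κ γ)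
    rwa [← numPlacesAbove_eq_index] at h
  obtain ⟨δ₁, hδ₁, hκδ₁⟩ := hpow
  have hκδ₁' : κ δ₁ = Multiplicative.ofAdd (N : ℤ_[p]) := by
    change κ δ₁ = _ at hκδ₁
    rw [hκδ₁, map_pow, hγ, ← ofAdd_nsmul, nsmul_one]
  set a : ℤ_[p] := (N : ℤ_[p]) with ha
  have ha0 : a ≠ 0 := by rw [ha]; exact_mod_cast hN0
  have hne₁ : κ δ₁ ≠ 1 := by
    rw [hκδ₁']
    exact fun h ↦ ha0 (by rw [ha]; exact ofAdd_eq_one.mp h)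
  have hκδ₁a : (κ δ₁).toAdd = a := by rw [hκδ₁', toAdd_ofAdd]
  -- n1011's factorisation at `δ₁`
  set x : ℤ_[p] := (κ σ).toAdd with hx
  have hy : ‖x - (x.appr a.valuation : ℤ_[p])‖ ≤ ‖(κ δ₁).toAdd‖ := by
    rw [hκδ₁a, PadicInt.norm_eq_zpow_neg_valuation ha0, PadicInt.norm_le_pow_iff_mem_span_pow]
    exact PadicInt.appr_spec _ x
  obtain ⟨δ, hδ, hκδ⟩ := exists_mem_decomp_apply_eq_of_norm_le κ hδ₁ hne₁ hy
  -- `p^{v_p N} ≤ N`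
  have hle : p ^ a.valuation ≤ N := by
    have hmem : a ∈ Ideal.span {(p : ℤ_[p]) ^ a.valuation} := by
      rw [← PadicInt.norm_le_pow_iff_mem_span_pow, PadicInt.norm_eq_zpow_neg_valuation ha0]
    rw [← PadicInt.ker_toZModPow, RingHom.mem_ker, ha, map_natCast,
      ZMod.natCast_eq_zero_iff] at hmem
    exact Nat.le_of_dvd (Nat.pos_of_ne_zero hN0) hmem
  refine ⟨x.appr a.valuation, lt_of_lt_of_le (PadicInt.appr_lt x _) hle, δ, hδ,
    σ * (δ * γ ^ (x.appr a.valuation))⁻¹, ?_, by rw [inv_mul_cancel_right]⟩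
  rw [ZpExtension.mem_kerSubgroup, map_mul, map_inv, map_mul, map_pow, hκδ, hγ,
    mul_inv_eq_one, ← ofAdd_toAdd (κ σ), ← hx, ← ofAdd_nsmul, ← ofAdd_add, nsmul_one,
    sub_add_cancel]

/-- The factorisation packaged as the `hrep` hypothesis of
`DatumSelmerQuotientCorankGeneric.zpCorank_quotient_le_sum` with `N w = numPlacesAbove κ w`, for a
finite set of places each finitely decomposed. [cite: GreenbergVatsal2000, §2 p. 21] -/
theorem hrep_numPlacesAbove {γ : absoluteGaloisGroup K} (hγ : κ.IsTopGenerator γ)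
    (S₀ : Finset (HeightOneSpectrum (𝓞 K)))
    (hD : ∀ v ∈ S₀, ∃ δ ∈ decomp (K := K) v, κ δ ≠ 1) :
    ∀ v ∈ S₀, ∀ σ : absoluteGaloisGroup K, ∃ n < numPlacesAbove κ v, ∃ δ ∈ decomp (K := K) v,
      ∃ h ∈ κ.kerSubgroup, σ = h * (δ * γ ^ n) := fun v hv σ ↦ by
  obtain ⟨δ₀, hδ₀, hne⟩ := hD v hv
  exact exists_lt_numPlacesAbove_eq_mul_decomp_mul_pow κ hγ hδ₀ hne σ

end Summit.BirchSwinnertonDyer.BirchSwinnertonDyer.Theorems.DecompositionCountNumPlaces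

end
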